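import Summits.NavierStokesRegularity.NavierStokesRegularity.Theorems.ExtremiserTransienceTwoThirdsLayerPointwise
import HarnessLib

/-!
# Route `ExtremiserTransience`, crux `NearExtremalTransiencePerFlow` (stmt-NavierStokesRegularity-26567), LINE g10-1 «two_thirds»
# (ns-idea-10 g10), stub S2 `FirstOrderIdentity`: the LAYER JUNK, pointwise bound of the layer integrand

Helper file for S2 (`--supports stmt-NavierStokesRegularity-26567`), sequel of `…TwoThirdsLayerPointwise`.  Combining the structure
lemma `abs_f1_le_of_struct` with the offsets of `φ₀ = χ·curl ψ − χV − curl(χψ)` gives a pointwise bound for the integrand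
`F = f₁(φ₀) + χ²(3·sd − κ⋆(zd + wd))` of the layer formula at a point where `‖Dʲχ‖ ≤ kⱼ` (`j = 1,2,3`), `0 ≤ χ ≤ 1`, `‖V‖ ≤ 1`,
`‖DV‖ ≤ A₁`:

* `abs_layerIntegrand_le` — `|F| ≤ C₀(zd+wd) + Σ (coefficient)·(‖V‖, ‖ψ‖, ‖Dψ‖)·‖ω‖ + Σ (coefficient)·(‖V‖, ‖DV‖, ‖ψ‖, ‖Dψ‖, ‖D²ψ‖)·√wd`
  with every coefficient carrying a factor `k₁`, `k₂` or `k₃` (the layer smallness), except `C₀ = 6A₁ + 2κ⋆ + k₁(1 + 3κ⋆/2)`;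
* `abs_layerIntegrand_le_collected` — after weighted AM–GM (`mul_le_weighted_sq`) with weights `s` (for `V`, `Dψ`), `t` (for `ψ`)
  and `1` (for `DV`, `D²ψ`), and one constant `K ≥ max(1, A₁, κ⋆, ‖curlCLM‖)`:
  `|F| ≤ 11K³·(Θ(zd+wd) + s(k₁+k₂)(‖V‖² + ‖Dψ‖²) + t(k₂+k₃)‖ψ‖² + k₁(‖DV‖² + ‖D²ψ‖²))`, `Θ = 1 + k₁ + (k₁+k₂)/s + (k₂+k₃)/t`.

HONEST FRAMING: calculus bookkeeping; nothing about Navier–Stokes regularity or blow-up is proved; S2, the crux ⟨26567⟩ and NS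
regularity are OPEN; no summit is proved by a line. [folklore]
-/

noncomputable section

open scoped Topology InnerProductSpace RealInnerProductSpace ENNReal ContDiff
open MeasureTheory Filter Set Metric
open Literature.Analysis.FluidPDE
open Summit.NavierStokesRegularity.NavierStokesRegularity.Theorems.DepletionLadder.KStar.HalfSpace
open Summit.NavierStokesRegularity.NavierStokesRegularity.Theorems.DepletionLadder
open Summit.NavierStokesRegularity.NavierStokesRegularity.Theorems.NearExtremalTransiencePerFlow.LocalMaximiser

namespace Summit.NavierStokesRegularity.NavierStokesRegularity.Theorems.NearExtremalTransiencePerFlow.TwoThirds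

-- the summit's namespace repeats the problem name by convention (D-0017)
set_option linter.dupNamespace false

variable {V ψ : E3 → E3} {χ : E3 → ℝ}

/-! ## The pointwise bound of the layer integrand -/

/-- Weighted AM–GM: `pq ≤ (t p² + q²/t)/2` for `t > 0`. [folklore] -/
theorem mul_le_weighted_sq {p q t : ℝ} (ht : 0 < t) : p * q ≤ (t * p ^ 2 + q ^ 2 / t) / 2 := by
  have e : q ^ 2 / t = t * (q / t) ^ 2 := by field_simp
  have e2 : p * q = t * (p * (q / t)) := by field_simp
  rw [e, e2]
  nlinarith [mul_nonneg ht.le (sq_nonneg (p - q / t))]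

/-- **POINTWISE BOUND OF THE LAYER INTEGRAND.**  At a point `x` with `0 ≤ χ(x) ≤ 1`, `‖Dχ(x)‖ ≤ k₁`, `‖D²χ(x)‖ ≤ k₂`, `‖D³χ(x)‖ ≤ k₃`,
`‖V(x)‖ ≤ 1`, `‖DV(x)‖ ≤ A₁`, the integrand `F = f₁(φ₀) + χ²(3·sd − κ⋆(zd+wd))` of the layer formula obeys
`|F(x)| ≤ C₀(zd+wd) + a₁‖V‖‖ω‖ + a₂‖ψ‖‖ω‖ + a₃‖Dψ‖‖ω‖ + (b₁‖V‖ + b₂‖DV‖ + b₃‖ψ‖ + b₄‖Dψ‖ + b₅‖D²ψ‖)√wd` with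
`C₀ = 6A₁ + 2κ⋆ + k₁(1 + 3κ⋆/2)`, `a₁ = (2A₁+κ⋆)ck₁`, `a₂ = (3A₁+κ⋆)c²k₂`, `a₃ = (3A₁+κ⋆)c²k₁`, `b₁ = 3κ⋆ck₂`, `b₂ = 3κ⋆ck₁`,
`b₃ = 3κ⋆c²k₃`, `b₄ = 6κ⋆c²k₂`, `b₅ = 3κ⋆c²k₁`, `c = ‖curlCLM‖`. [folklore] -/
theorem abs_layerIntegrand_le (hV : ContDiff ℝ (⊤ : ℕ∞) V) (hχ : ContDiff ℝ (⊤ : ℕ∞) χ) (hψ : ContDiff ℝ (⊤ : ℕ∞) ψ)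
    {x : E3} {A₁ k₁ k₂ k₃ : ℝ} (hχ0 : 0 ≤ χ x) (hχ1 : χ x ≤ 1) (hA : ‖fderiv ℝ V x‖ ≤ A₁) (hV1 : ‖V x‖ ≤ 1)
    (hk₁ : ‖fderiv ℝ χ x‖ ≤ k₁) (hk₂ : ‖iteratedFDeriv ℝ 2 χ x‖ ≤ k₂) (hk₃ : ‖iteratedFDeriv ℝ 3 χ x‖ ≤ k₃) :
    |f1 V (fun y => χ y • curl ψ y - χ y • V y - curl (fun z => χ z • ψ z) y) x +
        χ x ^ 2 * (3 * sd V x - kStar * (zd V x + wd V x))| ≤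
      (6 * A₁ + 2 * kStar + k₁ * (1 + 3 * kStar / 2)) * (zd V x + wd V x) +
      (2 * A₁ + kStar) * ‖curlCLM‖ * k₁ * (‖V x‖ * ‖curl V x‖) +
      (3 * A₁ + kStar) * ‖curlCLM‖ ^ 2 * k₂ * (‖ψ x‖ * ‖curl V x‖) +
      (3 * A₁ + kStar) * ‖curlCLM‖ ^ 2 * k₁ * (‖fderiv ℝ ψ x‖ * ‖curl V x‖) +
      3 * kStar * ‖curlCLM‖ * k₂ * (‖V x‖ * Real.sqrt (wd V x)) +
      3 * kStar * ‖curlCLM‖ * k₁ * (‖fderiv ℝ V x‖ * Real.sqrt (wd V x)) +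
      3 * kStar * ‖curlCLM‖ ^ 2 * k₃ * (‖ψ x‖ * Real.sqrt (wd V x)) +
      6 * kStar * ‖curlCLM‖ ^ 2 * k₂ * (‖fderiv ℝ ψ x‖ * Real.sqrt (wd V x)) +
      3 * kStar * ‖curlCLM‖ ^ 2 * k₁ * (‖iteratedFDeriv ℝ 2 ψ x‖ * Real.sqrt (wd V x)) := by
  have hK : 0 < kStar := kStar_pos
  have hA0 : 0 ≤ A₁ := (norm_nonneg _).trans hA
  have hk₁0 : 0 ≤ k₁ := (norm_nonneg _).trans hk₁
  have hk₂0 : 0 ≤ k₂ := (norm_nonneg _).trans hk₂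
  have hk₃0 : 0 ≤ k₃ := (norm_nonneg _).trans hk₃
  set c := ‖curlCLM‖ with hc
  have hc0 : 0 ≤ c := norm_nonneg curlCLM
  set φ₀ : E3 → E3 := fun y => χ y • curl ψ y - χ y • V y - curl (fun z => χ z • ψ z) y with hφ₀
  -- shorthand sizes at `x`
  set w := ‖curl V x‖ with hw
  set s := Real.sqrt (wd V x) with hs
  set nV := ‖V x‖
  set nDV := ‖fderiv ℝ V x‖
  set nψ := ‖ψ x‖
  set nDψ := ‖fderiv ℝ ψ x‖
  set nD2ψ := ‖iteratedFDeriv ℝ 2 ψ x‖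
  have hw0 : 0 ≤ w := norm_nonneg _
  have hs0 : 0 ≤ s := Real.sqrt_nonneg _
  have hnV0 : 0 ≤ nV := norm_nonneg _
  have hnDV0 : 0 ≤ nDV := norm_nonneg _
  have hnψ0 : 0 ≤ nψ := norm_nonneg _
  have hnDψ0 : 0 ≤ nDψ := norm_nonneg _
  have hnD2ψ0 : 0 ≤ nD2ψ := norm_nonneg _
  have hzd : zd V x = w ^ 2 := rfl
  have hzd0 : 0 ≤ zd V x := by rw [hzd]; positivity
  have hwd0 : 0 ≤ wd V x := frobeniusNormSq_nonneg _
  have hs2 : s ^ 2 = wd V x := Real.sq_sqrt hwd0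
  have hwle : w ≤ c * A₁ := (norm_curl_le V x).trans (mul_le_mul_of_nonneg_left hA hc0)
  have P4 : w * s ≤ (zd V x + wd V x) / 2 := by
    have h2 := two_mul_le_add_sq w s
    rw [hzd, ← hs2]
    linarith only [h2]
  have P4' : 3 * kStar * k₁ * (w * s) ≤ 3 * kStar * k₁ * ((zd V x + wd V x) / 2) :=
    mul_le_mul_of_nonneg_left P4 (by positivity)
  have P5 : |χ x ^ 2 * (3 * sd V x - kStar * (zd V x + wd V x))| ≤ 3 * A₁ * zd V x + kStar * (zd V x + wd V x) := by
    rw [abs_mul, abs_of_nonneg (sq_nonneg _)]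
    have hχ2 : χ x ^ 2 ≤ 1 := pow_le_one₀ hχ0 hχ1
    have hsd : |sd V x| ≤ A₁ * zd V x := (abs_sd_le V x).trans (mul_le_mul_of_nonneg_right hA hzd0)
    have h3 : |3 * sd V x - kStar * (zd V x + wd V x)| ≤ 3 * (A₁ * zd V x) + kStar * (zd V x + wd V x) := by
      calc |3 * sd V x - kStar * (zd V x + wd V x)| ≤ |3 * sd V x| + |kStar * (zd V x + wd V x)| := abs_sub _ _
        _ ≤ 3 * (A₁ * zd V x) + kStar * (zd V x + wd V x) := by
            rw [abs_mul, abs_of_pos (by norm_num : (0 : ℝ) < 3), abs_of_nonneg (mul_nonneg hK.le (add_nonneg hzd0 hwd0))]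
            linarith only [hsd]
    have h0 : 0 ≤ |3 * sd V x - kStar * (zd V x + wd V x)| := abs_nonneg _
    calc χ x ^ 2 * |3 * sd V x - kStar * (zd V x + wd V x)| ≤ 1 * |3 * sd V x - kStar * (zd V x + wd V x)| :=
          mul_le_mul_of_nonneg_right hχ2 h0
      _ ≤ _ := by rw [one_mul]; linarith only [h3]
  -- the structure lemma and the offsets
  have hstruct := abs_f1_le_of_struct (V := V) φ₀ hχ0 hχ1 hA
  have hβ := norm_beta_phi0_le hV hχ hψ x
  have hγ := norm_gamma_phi0_le hV hχ hψ x
  have hDφ := norm_fderiv_phi0_le hV hχ hψ x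
  set B := ‖curl φ₀ x + χ x • curl V x‖ with hB
  set Γ := ‖fderiv ℝ (curl φ₀) x + χ x • fderiv ℝ (curl V) x‖ with hΓ
  set Dφ := ‖fderiv ℝ φ₀ x‖ with hDφdef
  have hB0 : 0 ≤ B := norm_nonneg _
  have hΓ0 : 0 ≤ Γ := norm_nonneg _
  -- sizes of the offsets in terms of the `k`'s
  have hB' : B ≤ c * k₁ * nV + c * (c * (k₂ * nψ + k₁ * nDψ)) := by
    have t1 : c * ‖fderiv ℝ χ x‖ * nV ≤ c * k₁ * nV :=
      mul_le_mul_of_nonneg_right (mul_le_mul_of_nonneg_left hk₁ hc0) hnV0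
    have t2 : c * (c * (‖iteratedFDeriv ℝ 2 χ x‖ * nψ + ‖fderiv ℝ χ x‖ * nDψ)) ≤ c * (c * (k₂ * nψ + k₁ * nDψ)) :=
      mul_le_mul_of_nonneg_left (mul_le_mul_of_nonneg_left (add_le_add (mul_le_mul_of_nonneg_right hk₂ hnψ0)
        (mul_le_mul_of_nonneg_right hk₁ hnDψ0)) hc0) hc0
    linarith only [hβ, t1, t2]
  have hDφ' : Dφ ≤ A₁ + k₁ + c * (k₂ * nψ + k₁ * nDψ) := by
    have t1 : |χ x| * nDV ≤ 1 * A₁ := mul_le_mul (by rw [abs_of_nonneg hχ0]; exact hχ1) hA hnDV0 zero_le_one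
    have t2 : ‖fderiv ℝ χ x‖ * nV ≤ k₁ * 1 := mul_le_mul hk₁ hV1 hnV0 hk₁0
    have t3 : c * (‖iteratedFDeriv ℝ 2 χ x‖ * nψ + ‖fderiv ℝ χ x‖ * nDψ) ≤ c * (k₂ * nψ + k₁ * nDψ) :=
      mul_le_mul_of_nonneg_left (add_le_add (mul_le_mul_of_nonneg_right hk₂ hnψ0)
        (mul_le_mul_of_nonneg_right hk₁ hnDψ0)) hc0
    linarith only [hDφ, t1, t2, t3]
  have hΓ' : Γ ≤ k₁ * w + c * (k₂ * nV + k₁ * nDV) + c * (c * (k₃ * nψ + 2 * k₂ * nDψ + k₁ * nD2ψ)) := by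
    have t1 : ‖fderiv ℝ χ x‖ * w ≤ k₁ * w := mul_le_mul_of_nonneg_right hk₁ hw0
    have t2 : c * (‖iteratedFDeriv ℝ 2 χ x‖ * nV + ‖fderiv ℝ χ x‖ * nDV) ≤ c * (k₂ * nV + k₁ * nDV) :=
      mul_le_mul_of_nonneg_left (add_le_add (mul_le_mul_of_nonneg_right hk₂ hnV0)
        (mul_le_mul_of_nonneg_right hk₁ hnDV0)) hc0
    have t3a : ‖iteratedFDeriv ℝ 3 χ x‖ * nψ + 2 * ‖iteratedFDeriv ℝ 2 χ x‖ * nDψ + ‖fderiv ℝ χ x‖ * nD2ψ ≤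
        k₃ * nψ + 2 * k₂ * nDψ + k₁ * nD2ψ := by
      have u1 := mul_le_mul_of_nonneg_right hk₃ hnψ0
      have u2 := mul_le_mul_of_nonneg_right hk₂ hnDψ0
      have u3 := mul_le_mul_of_nonneg_right hk₁ hnD2ψ0
      linarith only [u1, u2, u3]
    have t3 : c * (c * (‖iteratedFDeriv ℝ 3 χ x‖ * nψ + 2 * ‖iteratedFDeriv ℝ 2 χ x‖ * nDψ + ‖fderiv ℝ χ x‖ * nD2ψ)) ≤
        c * (c * (k₃ * nψ + 2 * k₂ * nDψ + k₁ * nD2ψ)) :=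
      mul_le_mul_of_nonneg_left (mul_le_mul_of_nonneg_left t3a hc0) hc0
    linarith only [hγ, t1, t2, t3]
  -- the products
  have hBw0 : 0 ≤ (2 * A₁ + kStar) := by positivity
  have P1 : (2 * A₁ + kStar) * B * w ≤ (2 * A₁ + kStar) * (c * k₁ * nV + c * (c * (k₂ * nψ + k₁ * nDψ))) * w :=
    mul_le_mul_of_nonneg_right (mul_le_mul_of_nonneg_left hB' hBw0) hw0
  have P2a : Dφ * zd V x ≤ (A₁ + k₁ + c * (k₂ * nψ + k₁ * nDψ)) * zd V x := mul_le_mul_of_nonneg_right hDφ' hzd0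
  have P2b : zd V x ≤ c * A₁ * w := by rw [hzd, sq]; exact mul_le_mul_of_nonneg_right hwle hw0
  have P2c : c * (k₂ * nψ + k₁ * nDψ) * zd V x ≤ c * (k₂ * nψ + k₁ * nDψ) * (c * A₁ * w) :=
    mul_le_mul_of_nonneg_left P2b (by positivity)
  have P3 : 3 * kStar * Γ * s ≤
      3 * kStar * (k₁ * w + c * (k₂ * nV + k₁ * nDV) + c * (c * (k₃ * nψ + 2 * k₂ * nDψ + k₁ * nD2ψ))) * s :=
    mul_le_mul_of_nonneg_right (mul_le_mul_of_nonneg_left hΓ' (by positivity)) hs0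
  -- assemble
  have hc2 : c ^ 2 = c * c := sq c
  have hsplit : |f1 V φ₀ x + χ x ^ 2 * (3 * sd V x - kStar * (zd V x + wd V x))| ≤
      |f1 V φ₀ x| + |χ x ^ 2 * (3 * sd V x - kStar * (zd V x + wd V x))| := abs_add_le _ _
  have hW : 0 ≤ wd V x := hwd0
  rw [hc2]
  linarith only [hsplit, hstruct, P1, P2a, P2c, P3, P4', P5, mul_nonneg hk₁0 hW, mul_nonneg hA0 hW]

/-- **POINTWISE BOUND, COLLECTED FORM.**  Under `1 ≤ K`, `A₁, κ⋆, ‖curlCLM‖ ≤ K` and weights `s, t > 0`, the bound of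
`abs_layerIntegrand_le` becomes, after weighted AM–GM on every product,
`|F(x)| ≤ 11K³·(Θ(zd+wd) + s(k₁+k₂)(‖V‖² + ‖Dψ‖²) + t(k₂+k₃)‖ψ‖² + k₁(‖DV‖² + ‖D²ψ‖²))`,
`Θ = 1 + k₁ + (k₁+k₂)/s + (k₂+k₃)/t`. [folklore] -/
theorem abs_layerIntegrand_le_collected (hV : ContDiff ℝ (⊤ : ℕ∞) V) (hχ : ContDiff ℝ (⊤ : ℕ∞) χ) (hψ : ContDiff ℝ (⊤ : ℕ∞) ψ)
    {x : E3} {A₁ k₁ k₂ k₃ K s t : ℝ} (hχ0 : 0 ≤ χ x) (hχ1 : χ x ≤ 1) (hA : ‖fderiv ℝ V x‖ ≤ A₁) (hV1 : ‖V x‖ ≤ 1)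
    (hk₁ : ‖fderiv ℝ χ x‖ ≤ k₁) (hk₂ : ‖iteratedFDeriv ℝ 2 χ x‖ ≤ k₂) (hk₃ : ‖iteratedFDeriv ℝ 3 χ x‖ ≤ k₃)
    (hK : 1 ≤ K) (hAK : A₁ ≤ K) (hκK : kStar ≤ K) (hcK : ‖curlCLM‖ ≤ K) (hs : 0 < s) (ht : 0 < t) :
    |f1 V (fun y => χ y • curl ψ y - χ y • V y - curl (fun z => χ z • ψ z) y) x +
        χ x ^ 2 * (3 * sd V x - kStar * (zd V x + wd V x))| ≤
      11 * K ^ 3 * ((1 + k₁ + (k₁ + k₂) / s + (k₂ + k₃) / t) * (zd V x + wd V x) +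
        s * (k₁ + k₂) * (‖V x‖ ^ 2 + ‖fderiv ℝ ψ x‖ ^ 2) + t * (k₂ + k₃) * ‖ψ x‖ ^ 2 +
        k₁ * (‖fderiv ℝ V x‖ ^ 2 + ‖iteratedFDeriv ℝ 2 ψ x‖ ^ 2)) := by
  have h := abs_layerIntegrand_le (ψ := ψ) hV hχ hψ hχ0 hχ1 hA hV1 hk₁ hk₂ hk₃
  have hKst : 0 < kStar := kStar_pos
  have hA0 : 0 ≤ A₁ := (norm_nonneg _).trans hA
  have hk₁0 : 0 ≤ k₁ := (norm_nonneg _).trans hk₁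
  have hk₂0 : 0 ≤ k₂ := (norm_nonneg _).trans hk₂
  have hk₃0 : 0 ≤ k₃ := (norm_nonneg _).trans hk₃
  have hc0 : 0 ≤ ‖curlCLM‖ := norm_nonneg curlCLM
  have hK0 : 0 ≤ K := le_trans zero_le_one hK
  set c := ‖curlCLM‖ with hc
  -- atoms
  set Z := zd V x with hZ
  set W := wd V x with hW
  set w := ‖curl V x‖ with hw
  set σ := Real.sqrt (wd V x) with hσ
  set nV := ‖V x‖
  set nDV := ‖fderiv ℝ V x‖
  set nψ := ‖ψ x‖
  set nDψ := ‖fderiv ℝ ψ x‖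
  set nD2ψ := ‖iteratedFDeriv ℝ 2 ψ x‖
  have hw0 : 0 ≤ w := norm_nonneg _
  have hσ0 : 0 ≤ σ := Real.sqrt_nonneg _
  have hnV0 : 0 ≤ nV := norm_nonneg _
  have hnDV0 : 0 ≤ nDV := norm_nonneg _
  have hnψ0 : 0 ≤ nψ := norm_nonneg _
  have hnDψ0 : 0 ≤ nDψ := norm_nonneg _
  have hnD2ψ0 : 0 ≤ nD2ψ := norm_nonneg _
  have hZw : w ^ 2 = Z := rfl
  have hZ0 : 0 ≤ Z := by rw [← hZw]; positivity
  have hW0 : 0 ≤ W := frobeniusNormSq_nonneg _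
  have hσW : σ ^ 2 = W := Real.sq_sqrt hW0
  -- weighted AM–GM for the eight products
  have q1 : nV * w ≤ (s * nV ^ 2 + Z / s) / 2 := by rw [← hZw]; exact mul_le_weighted_sq hs
  have q2 : nψ * w ≤ (t * nψ ^ 2 + Z / t) / 2 := by rw [← hZw]; exact mul_le_weighted_sq ht
  have q3 : nDψ * w ≤ (s * nDψ ^ 2 + Z / s) / 2 := by rw [← hZw]; exact mul_le_weighted_sq hs
  have q4 : nV * σ ≤ (s * nV ^ 2 + W / s) / 2 := by rw [← hσW]; exact mul_le_weighted_sq hs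
  have q5 : nDV * σ ≤ (1 * nDV ^ 2 + W / 1) / 2 := by rw [← hσW]; exact mul_le_weighted_sq one_pos
  have q6 : nψ * σ ≤ (t * nψ ^ 2 + W / t) / 2 := by rw [← hσW]; exact mul_le_weighted_sq ht
  have q7 : nDψ * σ ≤ (s * nDψ ^ 2 + W / s) / 2 := by rw [← hσW]; exact mul_le_weighted_sq hs
  have q8 : nD2ψ * σ ≤ (1 * nD2ψ ^ 2 + W / 1) / 2 := by rw [← hσW]; exact mul_le_weighted_sq one_pos
  -- coefficient bounds
  have hc2 : c ^ 2 ≤ K ^ 2 := pow_le_pow_left₀ hc0 hcK 2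
  have hc20 : 0 ≤ c ^ 2 := sq_nonneg _
  have e1 : (2 * A₁ + kStar) * c ≤ 3 * K ^ 2 := by
    linarith only [mul_le_mul hAK hcK hc0 hK0, mul_le_mul hκK hcK hc0 hK0]
  have e2 : (3 * A₁ + kStar) * c ^ 2 ≤ 4 * K ^ 3 := by
    linarith only [mul_le_mul hAK hc2 hc20 hK0, mul_le_mul hκK hc2 hc20 hK0]
  have e3 : 3 * kStar * c ≤ 3 * K ^ 2 := by linarith only [mul_le_mul hκK hcK hc0 hK0]
  have e4 : 3 * kStar * c ^ 2 ≤ 3 * K ^ 3 := by linarith only [mul_le_mul hκK hc2 hc20 hK0]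
  have e5 : 6 * A₁ + 2 * kStar + k₁ * (1 + 3 * kStar / 2) ≤ 8 * K + 5 / 2 * K * k₁ := by
    linarith only [hAK, hκK, mul_le_mul_of_nonneg_left hκK hk₁0, le_mul_of_one_le_left hk₁0 hK]
  -- termwise
  have T0 : (6 * A₁ + 2 * kStar + k₁ * (1 + 3 * kStar / 2)) * (Z + W) ≤ (8 * K + 5 / 2 * K * k₁) * (Z + W) :=
    mul_le_mul_of_nonneg_right e5 (by positivity)
  have T1 : (2 * A₁ + kStar) * c * k₁ * (nV * w) ≤ 3 * K ^ 2 * k₁ * ((s * nV ^ 2 + Z / s) / 2) :=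
    mul_le_mul (mul_le_mul_of_nonneg_right e1 hk₁0) q1 (by positivity) (by positivity)
  have T2 : (3 * A₁ + kStar) * c ^ 2 * k₂ * (nψ * w) ≤ 4 * K ^ 3 * k₂ * ((t * nψ ^ 2 + Z / t) / 2) :=
    mul_le_mul (mul_le_mul_of_nonneg_right e2 hk₂0) q2 (by positivity) (by positivity)
  have T3 : (3 * A₁ + kStar) * c ^ 2 * k₁ * (nDψ * w) ≤ 4 * K ^ 3 * k₁ * ((s * nDψ ^ 2 + Z / s) / 2) :=
    mul_le_mul (mul_le_mul_of_nonneg_right e2 hk₁0) q3 (by positivity) (by positivity)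
  have T4 : 3 * kStar * c * k₂ * (nV * σ) ≤ 3 * K ^ 2 * k₂ * ((s * nV ^ 2 + W / s) / 2) :=
    mul_le_mul (mul_le_mul_of_nonneg_right e3 hk₂0) q4 (by positivity) (by positivity)
  have T5 : 3 * kStar * c * k₁ * (nDV * σ) ≤ 3 * K ^ 2 * k₁ * ((1 * nDV ^ 2 + W / 1) / 2) :=
    mul_le_mul (mul_le_mul_of_nonneg_right e3 hk₁0) q5 (by positivity) (by positivity)
  have T6 : 3 * kStar * c ^ 2 * k₃ * (nψ * σ) ≤ 3 * K ^ 3 * k₃ * ((t * nψ ^ 2 + W / t) / 2) :=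
    mul_le_mul (mul_le_mul_of_nonneg_right e4 hk₃0) q6 (by positivity) (by positivity)
  have T7 : 6 * kStar * c ^ 2 * k₂ * (nDψ * σ) ≤ 6 * K ^ 3 * k₂ * ((s * nDψ ^ 2 + W / s) / 2) := by
    have e4' : 6 * kStar * c ^ 2 ≤ 6 * K ^ 3 := by linarith
    exact mul_le_mul (mul_le_mul_of_nonneg_right e4' hk₂0) q7 (by positivity) (by positivity)
  have T8 : 3 * kStar * c ^ 2 * k₁ * (nD2ψ * σ) ≤ 3 * K ^ 3 * k₁ * ((1 * nD2ψ ^ 2 + W / 1) / 2) :=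
    mul_le_mul (mul_le_mul_of_nonneg_right e4 hk₁0) q8 (by positivity) (by positivity)
  -- the collected comparison (all coefficients against `11 K³`)
  have hK1 : 1 ≤ K ^ 2 := one_le_pow₀ hK
  have hK2 : K ≤ K ^ 3 := by linarith only [mul_le_mul_of_nonneg_left hK1 hK0]
  have hK3 : K ^ 2 ≤ K ^ 3 := by linarith only [mul_le_mul_of_nonneg_left hK (sq_nonneg K)]
  have hZs : 0 ≤ Z / s := by positivity
  have hZt : 0 ≤ Z / t := by positivity
  have hWs : 0 ≤ W / s := by positivity
  have hWt : 0 ≤ W / t := by positivity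
  have hK30 : 0 ≤ K ^ 3 := by positivity
  have m1 : K * (Z + W) ≤ K ^ 3 * (Z + W) := mul_le_mul_of_nonneg_right hK2 (by positivity)
  have m2 : K * (k₁ * (Z + W)) ≤ K ^ 3 * (k₁ * (Z + W)) := mul_le_mul_of_nonneg_right hK2 (by positivity)
  have m3 : K ^ 2 * (k₁ * (s * nV ^ 2 + Z / s)) ≤ K ^ 3 * (k₁ * (s * nV ^ 2 + Z / s)) :=
    mul_le_mul_of_nonneg_right hK3 (by positivity)
  have m4 : K ^ 2 * (k₂ * (s * nV ^ 2 + W / s)) ≤ K ^ 3 * (k₂ * (s * nV ^ 2 + W / s)) :=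
    mul_le_mul_of_nonneg_right hK3 (by positivity)
  have m5 : K ^ 2 * (k₁ * (nDV ^ 2 + W)) ≤ K ^ 3 * (k₁ * (nDV ^ 2 + W)) :=
    mul_le_mul_of_nonneg_right hK3 (by positivity)
  have n1 : 0 ≤ K ^ 3 * Z := by positivity
  have n1' : 0 ≤ K ^ 3 * W := by positivity
  have n2 : 0 ≤ K ^ 3 * (k₁ * Z) := by positivity
  have n2' : 0 ≤ K ^ 3 * (k₁ * W) := by positivity
  have n3 : 0 ≤ K ^ 3 * (k₁ * (Z / s)) := by positivity
  have n4 : 0 ≤ K ^ 3 * (k₂ * (Z / s)) := by positivity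
  have n5 : 0 ≤ K ^ 3 * (k₁ * (W / s)) := by positivity
  have n6 : 0 ≤ K ^ 3 * (k₂ * (W / s)) := by positivity
  have n7 : 0 ≤ K ^ 3 * (k₂ * (Z / t)) := by positivity
  have n8 : 0 ≤ K ^ 3 * (k₃ * (Z / t)) := by positivity
  have n9 : 0 ≤ K ^ 3 * (k₂ * (W / t)) := by positivity
  have n10 : 0 ≤ K ^ 3 * (k₃ * (W / t)) := by positivity
  have n11 : 0 ≤ K ^ 3 * (s * (k₁ * nV ^ 2)) := by positivity
  have n12 : 0 ≤ K ^ 3 * (s * (k₂ * nV ^ 2)) := by positivity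
  have n13 : 0 ≤ K ^ 3 * (s * (k₁ * nDψ ^ 2)) := by positivity
  have n14 : 0 ≤ K ^ 3 * (s * (k₂ * nDψ ^ 2)) := by positivity
  have n15 : 0 ≤ K ^ 3 * (t * (k₂ * nψ ^ 2)) := by positivity
  have n16 : 0 ≤ K ^ 3 * (t * (k₃ * nψ ^ 2)) := by positivity
  have n17 : 0 ≤ K ^ 3 * (k₁ * nDV ^ 2) := by positivity
  have n18 : 0 ≤ K ^ 3 * (k₁ * nD2ψ ^ 2) := by positivity
  have u1 : (k₁ + k₂) / s * (Z + W) = k₁ * (Z / s) + k₂ * (Z / s) + k₁ * (W / s) + k₂ * (W / s) := by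
    field_simp; ring
  have u2 : (k₂ + k₃) / t * (Z + W) = k₂ * (Z / t) + k₃ * (Z / t) + k₂ * (W / t) + k₃ * (W / t) := by
    field_simp; ring
  have final : (8 * K + 5 / 2 * K * k₁) * (Z + W) + 3 * K ^ 2 * k₁ * ((s * nV ^ 2 + Z / s) / 2) +
      4 * K ^ 3 * k₂ * ((t * nψ ^ 2 + Z / t) / 2) + 4 * K ^ 3 * k₁ * ((s * nDψ ^ 2 + Z / s) / 2) +
      3 * K ^ 2 * k₂ * ((s * nV ^ 2 + W / s) / 2) + 3 * K ^ 2 * k₁ * ((1 * nDV ^ 2 + W / 1) / 2) +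
      3 * K ^ 3 * k₃ * ((t * nψ ^ 2 + W / t) / 2) + 6 * K ^ 3 * k₂ * ((s * nDψ ^ 2 + W / s) / 2) +
      3 * K ^ 3 * k₁ * ((1 * nD2ψ ^ 2 + W / 1) / 2) ≤
      11 * K ^ 3 * ((1 + k₁ + (k₁ + k₂) / s + (k₂ + k₃) / t) * (Z + W) +
        s * (k₁ + k₂) * (nV ^ 2 + nDψ ^ 2) + t * (k₂ + k₃) * nψ ^ 2 + k₁ * (nDV ^ 2 + nD2ψ ^ 2)) := by
    rw [mul_add (11 * K ^ 3), mul_add (11 * K ^ 3), mul_add (11 * K ^ 3), add_mul, add_mul, add_mul, u1, u2]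
    linarith only [m1, m2, m3, m4, m5, n1, n1', n2, n2', n3, n4, n5, n6, n7, n8, n9, n10, n11, n12, n13, n14, n15, n16, n17, n18]
  linarith only [h, T0, T1, T2, T3, T4, T5, T6, T7, T8, final]

end Summit.NavierStokesRegularity.NavierStokesRegularity.Theorems.NearExtremalTransiencePerFlow.TwoThirds

end
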